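import Summits.Ventures.YMGap.FlowData.RectTubeTwistedSecondOrder
import Summits.Ventures.YMGap.FlowData.KernelMeanVarianceExpansion
import Summits.Ventures.YMGap.FlowData.RectTubeKernelTaylorTwo
import HarnessLib

/-!
# Venture YMGap, track Y3 FLOW-DATA — THE SECOND-ORDER STRONG-COUPLING LAW OF `ln λ₀` for the (twisted) rectangular tube:
# `ln ‖T_ζ‖ = J·E[Φ_ζ] + (J²/2)·Var(Φ_ζ) + J²·Var(E[Φ_ζ | a]) + O(|J|³)` with an explicit constant (theorems only)

HONEST FRAMING: venture file of the cell `pub-ymgap` (QuantumFields programme), track Y3 (FLOW-DATA); companion THEOREM for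
`FlowData/RectTubeTwistedSecondOrder.lean` (‖T_ζ‖ to second order in the distance to the rank-one projection),
`FlowData/KernelMeanVarianceExpansion.lean` (mean / row variance of a kernel with a second-order Taylor expansion) and
`FlowData/RectTubeKernelTaylorTwo.lean` (the Taylor data of the twisted slice kernel).  Finite rectangular tube `Π ℤ/Lᵢ`,
compact second-countable `G`, continuous unitary `ρ`, ANY plaquette field `ζ` (`ζ ≡ 1` = untwisted); the exponent of one
time step is `Φ_ζ(a, E, b) = ½ magTw_ζ(a) + ½ magTw_ζ(b) + elec(a, E, b)` (`|Φ_ζ| ≤ c := n(3#P + N)`), and for `|J| c ≤ 1/8`: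

* **`abs_log_norm_rectTubeTwistedOperator_sub_le`** — THE LAW:
  `|ln ‖T_ζ‖ − (J m₁ + (J²/2)(m₂ − m₁²) + J² V)| ≤ 100 (|J| c)³`, where `m₁ = ∫∫∫ Φ_ζ` (mean), `m₂ = ∫∫∫ Φ_ζ²`,
  `V = ∫_a (∫∫ Φ_ζ(a,E,b) dE db − m₁)² da` (variance of the conditional mean given the earlier slice).

For the cell's `SU(2)` one-site objects this is the input of `E_mag = β/2 + (k−2)β²/4 + O(β³)`.  Nothing about `L → ∞`, the
continuum or a mass gap; no number of the FLOW-TABLE.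

References: T. Kato (1966) §II.2 [cite: Kato1966, §II.2]; I. Montvay, G. Münster (1994) §3.2.6 [cite: MontvayMunster1994, §3.2.6];
K. Osterwalder, E. Seiler, Ann. Phys. 110 (1978) 440, §3 [cite: OsterwalderSeilerAnnPhys1978, §3].
-/

noncomputable section

open scoped BigOperators ENNReal InnerProductSpace
open MeasureTheory Filter Function Topology Finset
open Literature.MathematicalPhysics.QuantumFieldTheory Literature.Analysis.OperatorTheory
open Literature.MathematicalPhysics.QuantumLattice (RectTorusSite)
open Literature.Barriers.QuantumFields
open Summit.Ventures.YMGap.Census (RectPlaquette)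

namespace Summit.Ventures.YMGap.FlowData

section SecondOrderLaw

variable {G : Type*} [Group G] [TopologicalSpace G] [IsTopologicalGroup G] [CompactSpace G]
  [MeasurableSpace G] [BorelSpace G] [SecondCountableTopology G] {n k : ℕ} (ρ : G →* Matrix (Fin n) (Fin n) ℂ)
  (J : ℝ) {Ls : Fin k → ℕ} [∀ i, NeZero (Ls i)]

/-- **THE SECOND-ORDER STRONG-COUPLING LAW OF `ln λ₀`** for the (twisted) rectangular tube operator `T_ζ` (`ζ ≡ 1` allowed):
with `c = n(3#P + N)`, `Φ_ζ(a,E,b) = ½ magTw_ζ(a) + ½ magTw_ζ(b) + elec(a,E,b)`, `m₁ = ∫∫∫ Φ_ζ`, `m₂ = ∫∫∫ Φ_ζ²`,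
`V = ∫_a (∫_b ∫_E Φ_ζ − m₁)²`, and `|J| c ≤ 1/8`:
`|ln ‖T_ζ‖ − (J m₁ + (J²/2)(m₂ − m₁²) + J² V)| ≤ 100 (|J| c)³` — i.e.
`ln λ₀ = J E[Φ] + (J²/2) Var Φ + J² Var(E[Φ | earlier slice]) + O(J³)` (second-order Rayleigh–Schrödinger about the rank-one
projection at `J = 0`). [cite: Kato1966, §II.2] -/
theorem abs_log_norm_rectTubeTwistedOperator_sub_le (hρ : Continuous ρ) (hρu : ∀ g, ρ g ∈ Matrix.unitaryGroup (Fin n) ℂ)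
    (ζ : RectPlaquette Ls → G)
    (hJ : |J| * (n * (3 * (Fintype.card (RectTorusSite Ls) * Fintype.card {p : Fin k × Fin k // p.1 < p.2}) +
        Fintype.card (RectTorusSite Ls × Fin k))) ≤ 1 / 8) :
    |Real.log ‖rectTubeTwistedOperator ρ J Ls ζ‖ -
        (J * (∫ a, ∫ b, ∫ E, (rectMagSumTw ρ ζ a / 2 + rectMagSumTw ρ ζ b / 2 + rectElecSum ρ a E b)
              ∂(Measure.pi fun _ : RectTorusSite Ls => haarProbability G) ∂(rectSliceMeasure G Ls) ∂(rectSliceMeasure G Ls)) +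
          J ^ 2 / 2 * ((∫ a, ∫ b, ∫ E, (rectMagSumTw ρ ζ a / 2 + rectMagSumTw ρ ζ b / 2 + rectElecSum ρ a E b) ^ 2
              ∂(Measure.pi fun _ : RectTorusSite Ls => haarProbability G) ∂(rectSliceMeasure G Ls) ∂(rectSliceMeasure G Ls)) -
            (∫ a, ∫ b, ∫ E, (rectMagSumTw ρ ζ a / 2 + rectMagSumTw ρ ζ b / 2 + rectElecSum ρ a E b)
              ∂(Measure.pi fun _ : RectTorusSite Ls => haarProbability G) ∂(rectSliceMeasure G Ls) ∂(rectSliceMeasure G Ls))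
              ^ 2) +
          J ^ 2 * ∫ a, ((∫ b, ∫ E, (rectMagSumTw ρ ζ a / 2 + rectMagSumTw ρ ζ b / 2 + rectElecSum ρ a E b)
              ∂(Measure.pi fun _ : RectTorusSite Ls => haarProbability G) ∂(rectSliceMeasure G Ls)) -
            ∫ a, ∫ b, ∫ E, (rectMagSumTw ρ ζ a / 2 + rectMagSumTw ρ ζ b / 2 + rectElecSum ρ a E b)
              ∂(Measure.pi fun _ : RectTorusSite Ls => haarProbability G) ∂(rectSliceMeasure G Ls) ∂(rectSliceMeasure G Ls)) ^ 2
              ∂(rectSliceMeasure G Ls))| ≤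
      100 * (|J| * (n * (3 * (Fintype.card (RectTorusSite Ls) * Fintype.card {p : Fin k × Fin k // p.1 < p.2}) +
        Fintype.card (RectTorusSite Ls × Fin k)))) ^ 3 := by
  set c : ℝ := n * (3 * (Fintype.card (RectTorusSite Ls) * Fintype.card {p : Fin k × Fin k // p.1 < p.2}) +
        Fintype.card (RectTorusSite Ls × Fin k)) with hc
  set μE : Measure (RectTorusSite Ls → G) := Measure.pi fun _ : RectTorusSite Ls => haarProbability G with hμE
  set μ : Measure (RectSlice Ls G) := rectSliceMeasure G Ls with hμ
  set Φ : RectSlice Ls G → (RectTorusSite Ls → G) → RectSlice Ls G → ℝ := fun a E b =>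
    rectMagSumTw ρ ζ a / 2 + rectMagSumTw ρ ζ b / 2 + rectElecSum ρ a E b with hΦ
  set φ₁ : RectSlice Ls G → RectSlice Ls G → ℝ := fun a b => ∫ E, Φ a E b ∂μE with hφ₁
  set φ₂ : RectSlice Ls G → RectSlice Ls G → ℝ := fun a b => ∫ E, Φ a E b ^ 2 ∂μE with hφ₂
  set K : RectSlice Ls G → RectSlice Ls G → ℝ := rectSliceKernelTw (Ls := Ls) ρ ζ J J with hK
  set u : ℝ := |J| * c with hu
  have hc0 : 0 ≤ c := by positivity
  have hu0 : 0 ≤ u := mul_nonneg (abs_nonneg _) hc0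
  have hu8 : u ≤ 1 / 8 := hJ
  have hu1 : u ≤ 1 := by linarith
  -- bounds on Φ, φ₁, φ₂
  have hΦb : ∀ a E b, |Φ a E b| ≤ c := fun a E b => abs_stepExponent_le ρ (Ls := Ls) hρu ζ a E b
  have hbnd : ∀ {f : (RectTorusSite Ls → G) → ℝ} {C : ℝ}, (∀ E, |f E| ≤ C) → |∫ E, f E ∂μE| ≤ C :=
      fun {f} {C} hf => by
    have h := norm_integral_le_of_norm_le_const (μ := μE) (f := f) (C := C)
      (ae_of_all _ fun E => by rw [Real.norm_eq_abs]; exact hf E)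
    rwa [Real.norm_eq_abs, probReal_univ, mul_one] at h
  have hφ₁b : ∀ a b, |φ₁ a b| ≤ c := fun a b => hbnd fun E => hΦb a E b
  have hφ₂b : ∀ a b, |φ₂ a b| ≤ c ^ 2 := fun a b => hbnd fun E => by
    rw [abs_pow]; exact pow_le_pow_left₀ (abs_nonneg _) (hΦb a E b) 2
  -- joint measurability of K, φ₁, φ₂
  have hΦc : Continuous fun q : (RectSlice Ls G × RectSlice Ls G) × (RectTorusSite Ls → G) => Φ q.1.1 q.2 q.1.2 := by
    have h : Continuous fun z : (RectSlice Ls G × RectSlice Ls G) × (RectTorusSite Ls → G) =>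
        rectElecSum ρ z.1.1 z.2 z.1.2 := continuous_rectElecSum ρ (Ls := Ls) hρ
    have hm := continuous_rectMagSumTw ρ (Ls := Ls) hρ ζ
    have hm1 : Continuous fun z : (RectSlice Ls G × RectSlice Ls G) × (RectTorusSite Ls → G) => rectMagSumTw ρ ζ z.1.1 :=
      hm.comp (continuous_fst.comp continuous_fst)
    have hm2 : Continuous fun z : (RectSlice Ls G × RectSlice Ls G) × (RectTorusSite Ls → G) => rectMagSumTw ρ ζ z.1.2 :=
      hm.comp (continuous_snd.comp continuous_fst)
    have h3 : Continuous fun z : (RectSlice Ls G × RectSlice Ls G) × (RectTorusSite Ls → G) =>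
        rectMagSumTw ρ ζ z.1.1 / 2 + rectMagSumTw ρ ζ z.1.2 / 2 + rectElecSum ρ z.1.1 z.2 z.1.2 :=
      ((hm1.div_const 2).add (hm2.div_const 2)).add h
    exact h3
  have hKm : StronglyMeasurable (uncurry K) := stronglyMeasurable_rectSliceKernelTw ρ hρ ζ J J
  have hφ₁m : StronglyMeasurable (uncurry φ₁) := by
    have h := MeasureTheory.StronglyMeasurable.integral_prod_right' (ν := μE) hΦc.stronglyMeasurable
    exact h
  have hφ₂m : StronglyMeasurable (uncurry φ₂) := by
    have h := MeasureTheory.StronglyMeasurable.integral_prod_right' (ν := μE) (hΦc.pow 2).stronglyMeasurable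
    exact h
  -- kernel bounds
  have hKb : ∀ a b, |K a b| ≤ Real.exp u := fun a b => by
    obtain ⟨hlo, hhi⟩ := rectSliceKernelTw_mem_Icc_exp ρ (Ls := Ls) hρ hρu ζ J a b
    rw [abs_of_nonneg ((Real.exp_pos _).le.trans hlo)]
    exact hhi
  have hrem : ∀ a b, |K a b - 1 - J * φ₁ a b - J ^ 2 / 2 * φ₂ a b| ≤ u ^ 3 := fun a b =>
    abs_rectSliceKernelTw_taylor_le ρ J hρ hρu ζ (by rw [← hu]; exact hu1) a b
  -- PART B: mean and row variance of the kernel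
  have hmean := abs_mean_sub_le (μ := μ) (J := J) (c := c) (ε := u ^ 3) hKm hφ₁m hφ₂m hKb hφ₁b hφ₂b hrem
  have hvar := abs_rowVariance_sub_le (μ := μ) (J := J) (c := c) (ε := u ^ 3) hKm hφ₁m hφ₂m hKb hφ₁b hφ₂b hrem
  -- PART M1: ‖T_ζ‖ to second order; first-order window
  set T := rectTubeTwistedOperator ρ J Ls ζ with hT
  set one : Lp ℝ 2 μ := Lp.const 2 μ (1 : ℝ) with hone
  have hη : Real.exp u - 1 ≤ 1 / 4 := by
    have h := Real.abs_exp_sub_one_sub_id_le (x := u) (by rw [abs_of_nonneg hu0]; exact hu1)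
    have h2 := (abs_le.1 h).2
    nlinarith
  have hηu : Real.exp u - 1 ≤ 2 * u := by
    have h := Real.abs_exp_sub_one_sub_id_le (x := u) (by rw [abs_of_nonneg hu0]; exact hu1)
    have h2 := (abs_le.1 h).2
    nlinarith
  have hη0 : 0 ≤ Real.exp u - 1 := by rw [sub_nonneg]; exact Real.one_le_exp hu0
  have hsecond := abs_norm_rectTubeTwistedOperator_sub_second_order_le ρ J hρ hρu ζ hη
  have hone1 : ‖one‖ = 1 := by
    rw [hone, Lp.norm_const' (μ := μ) (p := 2) (c := (1 : ℝ)) two_ne_zero ENNReal.ofNat_ne_top, norm_one,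
      probReal_univ, Real.one_rpow, one_mul]
  have hlow : 1 - (Real.exp u - 1) ≤ ‖T‖ :=
    one_sub_le_norm_of_near_rankOne T hone1 (norm_rectTubeTwistedOperator_sub_rankOne_le ρ J hρ hρu ζ)
  have hhigh : ‖T‖ ≤ 1 + (Real.exp u - 1) :=
    norm_le_one_add_of_near_rankOne T hone1 hη0 (norm_rectTubeTwistedOperator_sub_rankOne_le ρ J hρ hρu ζ)
  -- the scalar quantities as kernel integrals
  have ht : @inner ℝ _ _ one (T one) = ∫ a, ∫ b, K a b ∂μ ∂μ := inner_one_rectTubeTwistedOperator_one_eq ρ J hρ ζ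
  have hv : ‖T one - (@inner ℝ _ _ one (T one)) • one‖ ^ 2 = ∫ a, ((∫ b, K a b ∂μ) - ∫ a, ∫ b, K a b ∂μ ∂μ) ^ 2 ∂μ := by
    rw [norm_sq_rectTubeTwistedOperator_one_sub_eq ρ J hρ ζ, ht]
  rw [hv, ht] at hsecond
  -- abbreviations for the main terms
  set m₁ : ℝ := ∫ a, ∫ b, φ₁ a b ∂μ ∂μ with hm₁
  set m₂ : ℝ := ∫ a, ∫ b, φ₂ a b ∂μ ∂μ with hm₂
  set V : ℝ := ∫ a, ((∫ b, φ₁ a b ∂μ) - m₁) ^ 2 ∂μ with hV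
  set t : ℝ := ∫ a, ∫ b, K a b ∂μ ∂μ with htt
  set v : ℝ := ∫ a, ((∫ b, K a b ∂μ) - t) ^ 2 ∂μ with hvv
  -- sizes of the main terms
  have hbndμ : ∀ {f : RectSlice Ls G → ℝ} {C : ℝ}, (∀ a, |f a| ≤ C) → |∫ a, f a ∂μ| ≤ C := fun {f} {C} hf => by
    have h := norm_integral_le_of_norm_le_const (μ := μ) (f := f) (C := C)
      (ae_of_all _ fun a => by rw [Real.norm_eq_abs]; exact hf a)
    rwa [Real.norm_eq_abs, probReal_univ, mul_one] at h
  have hm₁b : |m₁| ≤ c := hbndμ fun a => hbndμ fun b => hφ₁b a b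
  have hm₂b : |m₂| ≤ c ^ 2 := hbndμ fun a => hbndμ fun b => hφ₂b a b
  have hV0 : 0 ≤ V := integral_nonneg fun a => sq_nonneg _
  have hVb : V ≤ 4 * c ^ 2 := by
    have h : |V| ≤ (2 * c) ^ 2 := hbndμ fun a => by
      rw [abs_pow]
      refine pow_le_pow_left₀ (abs_nonneg _) ?_ 2
      calc |(∫ b, φ₁ a b ∂μ) - m₁| ≤ |∫ b, φ₁ a b ∂μ| + |m₁| := abs_sub _ _
        _ ≤ c + c := add_le_add (hbndμ fun b => hφ₁b a b) hm₁b
        _ = 2 * c := by ring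
    rw [abs_of_nonneg hV0] at h
    linarith
  have hu2 : u ^ 2 = J ^ 2 * c ^ 2 := by rw [hu, mul_pow, sq_abs]
  have h1 : |J * m₁| ≤ u := by rw [abs_mul, hu]; exact mul_le_mul_of_nonneg_left hm₁b (abs_nonneg _)
  have h2 : |J ^ 2 / 2 * m₂| ≤ u ^ 2 / 2 := by
    rw [abs_mul, abs_of_nonneg (by positivity : (0:ℝ) ≤ J ^ 2 / 2), hu2]
    have := mul_le_mul_of_nonneg_left hm₂b (by positivity : (0:ℝ) ≤ J ^ 2 / 2)
    linarith
  have h3 : 0 ≤ J ^ 2 * V := by positivity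
  have h3' : J ^ 2 * V ≤ 4 * u ^ 2 := by
    calc J ^ 2 * V ≤ J ^ 2 * (4 * c ^ 2) := mul_le_mul_of_nonneg_left hVb (sq_nonneg J)
      _ = 4 * u ^ 2 := by rw [hu2]; ring
  -- the three second-order data
  have hvar' : |v - J ^ 2 * V| ≤ 6 * u ^ 3 := by
    refine hvar.trans ?_
    rw [← hu2, show 4 * |J| * c = 4 * u by rw [hu]; ring]
    have hA : u ^ 2 + 2 * u ^ 3 ≤ 5 / 4 * u ^ 2 := by nlinarith only [hu0, hu8]
    have hB : 4 * u + (u ^ 2 + 2 * u ^ 3) ≤ 21 / 5 * u := by nlinarith only [hu0, hu8]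
    have hC : (u ^ 2 + 2 * u ^ 3) * (4 * u + (u ^ 2 + 2 * u ^ 3)) ≤ (5 / 4 * u ^ 2) * (21 / 5 * u) :=
      mul_le_mul hA hB (by positivity) (by positivity)
    have hD : (5 / 4 * u ^ 2) * (21 / 5 * u) ≤ 6 * u ^ 3 := by nlinarith only [hu0]
    exact hC.trans hD
  have hN : |‖T‖ - (t + v)| ≤ 32 * u ^ 3 := by
    refine hsecond.trans ?_
    have h := pow_le_pow_left₀ hη0 hηu 3
    calc 4 * (Real.exp u - 1) ^ 3 ≤ 4 * (2 * u) ^ 3 := by linarith [h]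
      _ = 32 * u ^ 3 := by ring
  exact abs_log_sub_secondOrder_le hu0 hu8 h1 h2 h3 h3' hmean hvar' hN

end SecondOrderLaw

end Summit.Ventures.YMGap.FlowData
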